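import Summits.QuantumFields.YangMills.Theorems.UnitScaleTiltProp7SymFrameLetters
import HarnessLib

/-!
# [Balaban1985Averaging] (89): the COVARIANT double-bar average — ONE STEP, relative to the background

W1 (part 2 of 2) of the (47)-twˢ plan (★★OWNER RULING g26-№12 (T-sym-frames), ACK 26 (2)): the `U₀ ≠ 1` twin of
`Prop8ChartDoubleBar.norm_dbarAvgU_sub_one_le` (✓ `…Prop8ChartDoubleBarOneStep`) for the covariant double bar
`dbarCovU U₀ W = (emlAvgU W)^{vframeCovU⁻¹}` ((89)) of ✓ `…Prop7SymFrameCovDefs`, on the frame letters of part 1 (`…Prop7SymFrameLetters`).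

Letters (generic complete normed `ℂ`-algebra `𝔸` with `‖1‖ = 1`; `ℓ = (d+2)L`): two-block reads `‖U₀(b) − 1‖ ≤ s₀` (background),
`‖W(b) − 1‖ ≤ s₁` (field) and the DIFFERENCE read `‖W(b) − U₀(b)‖ ≤ δ`, at `120ℓ(s₀+s₁) ≤ 1`.

* `norm_dbarCovU_mul_inv_sub_one_le` (the one-step row W2 inducts on, RIGHT placement of `Ū₀⁻¹`):
  `‖(dbarCovU U₀ W)(c)·(emlAvgU U₀)(c)⁻¹ − 1‖ ≤ L·δ + 22100·ℓ²·(s₀+s₁)²` — tube constant exactly `L` on the difference reads, because the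
  comb means of BOTH fields cancel against the frames (`lin_sub_comb_add_comb_eq_seg`: `Lin_c(Z) − λ̄_{c₋}(Z) + λ̄_{c₊}(Z) = |I|⁻¹Σ Z(segment)`);
* `norm_dbarCovU_sub_one_le`: the ABSOLUTE row `‖(dbarCovU U₀ W)(c) − 1‖ ≤ 17ℓs₀ + (1 + 17ℓs₀)(L·δ + 22100·ℓ²·(s₀+s₁)²)`.
The assembly is abstracted over the letters (`cov_dbar_bookkeeping`, pure normed-ring algebra + `cov_step_numerics`), then instantiated.

No analytic axioms; rung R3 of the programme, not the Clay statement; the YM mass gap is NOT proved here.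
-/

noncomputable section

open scoped BigOperators
open NormedSpace

namespace Summit.QuantumFields.YangMills.Theorems.Prop7SymAvgTwSym

open Literature.MathematicalPhysics.QuantumFieldTheory.Balaban1983to89
open T4Continuum BlockAveraging AveragingRT ExpMeanLog MatrixLog BlockAveragingEMLLinearised
open B10Eq27TorusAxialLog (holT gaugeActT gaugeActT_apply)
open Summit.QuantumFields.YangMills.Theorems.Prop8Chart
open Summit.QuantumFields.YangMills.Theorems.Prop8ChartDoubleBar

variable {P : Params} {j : ℕ}
variable {𝔸 : Type*} [NormedRing 𝔸] [NormedAlgebra ℂ 𝔸] [CompleteSpace 𝔸]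

/-- (89) at a coarse bond, on values: `(V̿W)(c) = w(c₋)⁻¹·W̄(c)·w(c₊)`. [cite: Balaban1985Averaging, (89) p.31] -/
theorem coe_dbarCovU (U₀ W : GaugeField P j 𝔸ˣ) (c : PBond P (j + 1)) :
    ((dbarCovU U₀ W c : 𝔸ˣ) : 𝔸) = (((vframeCovU U₀ W c.src)⁻¹ : 𝔸ˣ) : 𝔸) * ((emlAvgU W c : 𝔸ˣ) : 𝔸) * ((vframeCovU U₀ W c.tgt : 𝔸ˣ) : 𝔸) := by
  rw [dbarCovU_apply, Units.val_mul, Units.val_mul]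

variable [NormOneClass 𝔸]

/-! ## ★ The covariant double-bar one step ((89) at a background `U₀`) -/

omit [NormedAlgebra ℂ 𝔸] [CompleteSpace 𝔸] [NormOneClass 𝔸] in
/-- Two factors to first order: `‖g·G − 1 − (x + F)‖ ≤ ‖g − 1‖·‖G − 1‖ + ‖g − 1 − x‖ + ‖G − 1 − F‖`. [folklore] -/
theorem norm_two_factors_sub_lin_le (g G x F : 𝔸) :
    ‖g * G - 1 - (x + F)‖ ≤ ‖g - 1‖ * ‖G - 1‖ + ‖g - 1 - x‖ + ‖G - 1 - F‖ := by
  have e : g * G - 1 - (x + F) = (g - 1) * (G - 1) + ((g - 1 - x) + (G - 1 - F)) := by noncomm_ring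
  rw [e]
  exact norm_add_le_of_le (norm_mul_le _ _) (norm_add_le _ _) |>.trans (le_of_eq (by ring))

omit [NormedAlgebra ℂ 𝔸] [CompleteSpace 𝔸] in
/-- The inverse of a near-`1` element to second order from a one-sided inverse: `u′·u = 1`, `‖u − 1‖ ≤ b ≤ ½`, `‖u − 1 − τ‖ ≤ b₂` ⇒ `‖u′ − 1‖ ≤ 2b` and
`‖u′ − (1 − τ)‖ ≤ 2b² + b₂`. [folklore] -/
theorem norm_inv_model_le {u u' τ : 𝔸} {b b₂ : ℝ} (hinv : u' * u = 1) (hu : ‖u - 1‖ ≤ b) (hb : b ≤ 1 / 2) (huτ : ‖u - 1 - τ‖ ≤ b₂) :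
    ‖u' - 1‖ ≤ 2 * b ∧ ‖u' - (1 + -τ)‖ ≤ 2 * b ^ 2 + b₂ := by
  have e1 : u' - 1 = u' * (1 - u) := by rw [mul_sub, mul_one, hinv]
  have h1 : ‖u' - 1‖ ≤ 2 * b := by
    have h : ‖u' - 1‖ ≤ (‖u' - 1‖ + 1) * b := by
      calc ‖u' - 1‖ = ‖u' * (1 - u)‖ := by rw [← e1]
        _ ≤ ‖u'‖ * ‖1 - u‖ := norm_mul_le _ _
        _ ≤ (‖u' - 1‖ + 1) * b := by
            refine mul_le_mul ?_ (by rw [norm_sub_rev]; exact hu) (norm_nonneg _) (by positivity)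
            calc ‖u'‖ = ‖(u' - 1) + 1‖ := by rw [sub_add_cancel]
              _ ≤ ‖u' - 1‖ + 1 := norm_add_le_of_le le_rfl norm_one.le
    nlinarith [norm_nonneg (u' - 1), (norm_nonneg _).trans hu]
  refine ⟨h1, ?_⟩
  have e2 : u' - 1 + (u - 1) = (u' - 1) * (1 - u) := by noncomm_ring [hinv]
  have h2 : ‖u' - 1 + (u - 1)‖ ≤ 2 * b ^ 2 := by
    rw [e2]
    calc _ ≤ ‖u' - 1‖ * ‖1 - u‖ := norm_mul_le _ _
      _ ≤ (2 * b) * b := mul_le_mul h1 (by rw [norm_sub_rev]; exact hu) (norm_nonneg _) (by linarith [(norm_nonneg _).trans hu])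
      _ = 2 * b ^ 2 := by ring
  have e3 : u' - (1 + -τ) = (u' - 1 + (u - 1)) - (u - 1 - τ) := by abel
  rw [e3]
  exact norm_sub_le_of_le h2 huτ

/-- Real-number bookkeeping of the covariant one step (`θ = ℓ(s₀+s₁) ≤ 1/120`). [folklore] -/
theorem cov_step_numerics {θ nVp nU0i E3 nG : ℝ} (hθ0 : 0 ≤ θ) (hθ : θ ≤ 1 / 120)
    (hnU0i0 : 0 ≤ nU0i) (hnVp : nVp ≤ 1 + 36 * θ) (hnU0i : nU0i ≤ 1 + 34 * θ)
    (hE3 : E3 ≤ 660 * θ ^ 2 * nVp * nU0i + (1 + 24 * θ) * (3000 * θ ^ 2) * nU0i + (1 + 24 * θ) * (1 + 2 * θ) * (1238 * θ ^ 2) +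
      ((24 * θ) * (2 * θ) + (24 * θ) * (24 * θ) + (2 * θ) * (24 * θ) + (24 * θ) * (2 * θ) * (24 * θ)))
    (hG : nG ≤ E3 + 50 * θ) :
    (72 * θ) * nG + (2 * (36 * θ) ^ 2 + 3000 * θ ^ 2) + E3 ≤ 22100 * θ ^ 2 := by
  have hθ2 : 0 ≤ θ ^ 2 := sq_nonneg θ
  have h1 : nVp * nU0i ≤ (1 + 36 * θ) * (1 + 34 * θ) := mul_le_mul hnVp hnU0i hnU0i0 (by linarith)
  have h2 : (1 + 36 * θ) * (1 + 34 * θ) ≤ 17 / 10 := by nlinarith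
  have h3 : (1 + 24 * θ) * nU0i ≤ 31 / 20 := by nlinarith
  have h4 : (1 + 24 * θ) * (1 + 2 * θ) ≤ 13 / 10 := by nlinarith
  have hE3' : E3 ≤ 8000 * θ ^ 2 := by
    have t1 : 660 * θ ^ 2 * nVp * nU0i ≤ 660 * θ ^ 2 * (17 / 10) := by
      have : 660 * θ ^ 2 * nVp * nU0i = 660 * θ ^ 2 * (nVp * nU0i) := by ring
      rw [this]; exact mul_le_mul_of_nonneg_left (h1.trans h2) (by positivity)
    have t2 : (1 + 24 * θ) * (3000 * θ ^ 2) * nU0i ≤ 3000 * θ ^ 2 * (31 / 20) := by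
      have : (1 + 24 * θ) * (3000 * θ ^ 2) * nU0i = 3000 * θ ^ 2 * ((1 + 24 * θ) * nU0i) := by ring
      rw [this]; exact mul_le_mul_of_nonneg_left h3 (by positivity)
    have t3 : (1 + 24 * θ) * (1 + 2 * θ) * (1238 * θ ^ 2) ≤ (13 / 10) * (1238 * θ ^ 2) := mul_le_mul_of_nonneg_right h4 (by positivity)
    nlinarith
  have hG' : nG ≤ 117 * θ := by nlinarith
  nlinarith [mul_le_mul_of_nonneg_left hG' (by positivity : (0:ℝ) ≤ 72 * θ)]

omit [NormedAlgebra ℂ 𝔸] [CompleteSpace 𝔸] in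
/-- **THE COVARIANT ONE STEP, ABSTRACTED** over the letters (four factors `Vinv·U·Vp·U0i`, their first-order models, the exact first-order sum `F`).
[cite: Balaban1985Averaging, (89) p.31, (121)-(125) p.36] -/
theorem cov_dbar_bookkeeping {Vinv Vval U Vp U0 U0i mM mP LinW Lin0 F : 𝔸} {θ εB : ℝ} (hθ0 : 0 ≤ θ) (hθ : θ ≤ 1 / 120)
    (hinvV : Vinv * Vval = 1) (hinvU : U0i * U0 = 1)
    (hVm : ‖Vval - 1 - mM‖ ≤ 3000 * θ ^ 2) (hV1 : ‖Vval - 1‖ ≤ 36 * θ)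
    (hVpm : ‖Vp - 1 - mP‖ ≤ 3000 * θ ^ 2) (hVp1 : ‖Vp - 1‖ ≤ 36 * θ)
    (hUlin : ‖U - 1 - LinW‖ ≤ 660 * θ ^ 2)
    (hU0lin : ‖U0 - 1 - Lin0‖ ≤ 660 * θ ^ 2) (hU01 : ‖U0 - 1‖ ≤ 17 * θ)
    (hmP : ‖mP‖ ≤ 2 * θ) (hLinW : ‖LinW‖ ≤ 24 * θ) (hLin0 : ‖Lin0‖ ≤ 24 * θ)
    (hF : -mM + (LinW + mP + -Lin0) = F) (hFB : ‖F‖ ≤ εB) :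
    ‖Vinv * U * Vp * U0i - 1‖ ≤ εB + 22100 * θ ^ 2 := by
  -- inverses to second order
  have hb36 : 36 * θ ≤ 1 / 2 := by linarith
  have hb17 : 17 * θ ≤ 1 / 2 := by linarith
  obtain ⟨hVinv1, hVinvm⟩ := norm_inv_model_le hinvV hV1 hb36 hVm
  obtain ⟨hU0i1, hU0im⟩ := norm_inv_model_le hinvU hU01 hb17 hU0lin
  -- the three right factors `U·Vp·U0i` against `(1+LinW)(1+mP)(1−Lin0)`
  have hUmodel : ‖U - (1 + LinW)‖ ≤ 660 * θ ^ 2 := by rw [show U - (1 + LinW) = U - 1 - LinW by abel]; exact hUlin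
  have hVpmodel : ‖Vp - (1 + mP)‖ ≤ 3000 * θ ^ 2 := by rw [show Vp - (1 + mP) = Vp - 1 - mP by abel]; exact hVpm
  have hU0imodel : ‖U0i - (1 + -Lin0)‖ ≤ 1238 * θ ^ 2 := hU0im.trans (by nlinarith)
  have hx1 : ‖(1 : 𝔸) + LinW‖ ≤ 1 + 24 * θ := norm_add_le_of_le norm_one.le hLinW
  have hy1 : ‖(1 : 𝔸) + mP‖ ≤ 1 + 2 * θ := norm_add_le_of_le norm_one.le hmP
  have hnLin0 : ‖-Lin0‖ ≤ 24 * θ := by rw [norm_neg]; exact hLin0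
  have hm3 := norm_triple_sub_models_le hUmodel hVpmodel hU0imodel hx1 hy1
  have hf3 := norm_three_factors_sub_lin_le LinW mP (-Lin0)
  have hVpn : ‖Vp‖ ≤ 1 + 36 * θ := by
    calc ‖Vp‖ = ‖(Vp - 1) + 1‖ := by rw [sub_add_cancel]
      _ ≤ ‖Vp - 1‖ + 1 := norm_add_le_of_le le_rfl norm_one.le
      _ ≤ 1 + 36 * θ := by linarith
  have hU0in : ‖U0i‖ ≤ 1 + 34 * θ := by
    calc ‖U0i‖ = ‖(U0i - 1) + 1‖ := by rw [sub_add_cancel]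
      _ ≤ ‖U0i - 1‖ + 1 := norm_add_le_of_le le_rfl norm_one.le
      _ ≤ 1 + 34 * θ := by linarith
  set G : 𝔸 := U * Vp * U0i with hG
  set F3 : 𝔸 := LinW + mP + -Lin0 with hF3
  have hE3 : ‖G - 1 - F3‖ ≤ 660 * θ ^ 2 * ‖Vp‖ * ‖U0i‖ + (1 + 24 * θ) * (3000 * θ ^ 2) * ‖U0i‖ + (1 + 24 * θ) * (1 + 2 * θ) * (1238 * θ ^ 2) +
      (‖LinW‖ * ‖mP‖ + ‖LinW‖ * ‖-Lin0‖ + ‖mP‖ * ‖-Lin0‖ + ‖LinW‖ * ‖mP‖ * ‖-Lin0‖) := by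
    have e : G - 1 - F3 = (U * Vp * U0i - (1 + LinW) * (1 + mP) * (1 + -Lin0)) + ((1 + LinW) * (1 + mP) * (1 + -Lin0) - 1 - (LinW + mP + -Lin0)) := by
      rw [hG, hF3]; abel
    rw [e]
    exact norm_add_le_of_le hm3 hf3
  have hE3' : ‖G - 1 - F3‖ ≤ 660 * θ ^ 2 * ‖Vp‖ * ‖U0i‖ + (1 + 24 * θ) * (3000 * θ ^ 2) * ‖U0i‖ + (1 + 24 * θ) * (1 + 2 * θ) * (1238 * θ ^ 2) +
      ((24 * θ) * (2 * θ) + (24 * θ) * (24 * θ) + (2 * θ) * (24 * θ) + (24 * θ) * (2 * θ) * (24 * θ)) := by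
    refine hE3.trans (add_le_add le_rfl ?_)
    have t1 : ‖LinW‖ * ‖mP‖ ≤ (24 * θ) * (2 * θ) := mul_le_mul hLinW hmP (norm_nonneg _) (by positivity)
    have t2 : ‖LinW‖ * ‖-Lin0‖ ≤ (24 * θ) * (24 * θ) := mul_le_mul hLinW hnLin0 (norm_nonneg _) (by positivity)
    have t3 : ‖mP‖ * ‖-Lin0‖ ≤ (2 * θ) * (24 * θ) := mul_le_mul hmP hnLin0 (norm_nonneg _) (by positivity)
    have t4 : ‖LinW‖ * ‖mP‖ * ‖-Lin0‖ ≤ (24 * θ) * (2 * θ) * (24 * θ) := mul_le_mul t1 hnLin0 (norm_nonneg _) (by positivity)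
    linarith
  have hF3n : ‖F3‖ ≤ 50 * θ := by
    rw [hF3]; exact norm_add_le_of_le (norm_add_le_of_le hLinW hmP) hnLin0 |>.trans (by linarith)
  have hG1 : ‖G - 1‖ ≤ ‖G - 1 - F3‖ + 50 * θ := by
    calc ‖G - 1‖ = ‖(G - 1 - F3) + F3‖ := by rw [sub_add_cancel]
      _ ≤ ‖G - 1 - F3‖ + ‖F3‖ := norm_add_le _ _
      _ ≤ _ := by linarith
  -- the left factor `Vinv` against `1 − mM`
  have h2f := norm_two_factors_sub_lin_le Vinv G (-mM) F3
  have hassoc : Vinv * U * Vp * U0i = Vinv * G := by rw [hG]; noncomm_ring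
  have hlin : -mM + F3 = F := by rw [hF3]; exact hF
  rw [hassoc]
  have hT : ‖Vinv * G - 1 - (-mM + F3)‖ ≤ (72 * θ) * ‖G - 1‖ + (2 * (36 * θ) ^ 2 + 3000 * θ ^ 2) + ‖G - 1 - F3‖ := by
    refine h2f.trans (add_le_add (add_le_add ?_ ?_) le_rfl)
    · exact mul_le_mul (hVinv1.trans (by linarith)) le_rfl (norm_nonneg _) (by positivity)
    · rw [show Vinv - 1 - -mM = Vinv - (1 + -mM) by abel]; exact hVinvm
  have hnum := cov_step_numerics (nVp := ‖Vp‖) (nU0i := ‖U0i‖) (E3 := ‖G - 1 - F3‖) (nG := ‖G - 1‖) hθ0 hθ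
    (norm_nonneg _) hVpn hU0in hE3' hG1
  calc ‖Vinv * G - 1‖ = ‖(Vinv * G - 1 - (-mM + F3)) + F‖ := by rw [hlin, sub_add_cancel]
    _ ≤ ‖Vinv * G - 1 - (-mM + F3)‖ + ‖F‖ := norm_add_le _ _
    _ ≤ εB + 22100 * θ ^ 2 := by linarith


omit [CompleteSpace 𝔸] [NormOneClass 𝔸] in
/-- **THE STAIRCASE SUMS CANCEL AGAINST THE FRAMES** (for any bond field `Z`): `Lin_c(Z) − λ̄_{c₋}(Z) + λ̄_{c₊}(Z) = |I|⁻¹Σ_i Z(segment_i)` — the second ordering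
`σ′` is a dummy (`sum_idx_swap`). [cite: Balaban1985Averaging, (124)-(125) p.36] -/
theorem lin_sub_comb_add_comb_eq_seg (Z : PBond P j → 𝔸) (c : PBond P (j + 1)) :
    ((Fintype.card (Idx P) : ℂ))⁻¹ • ∑ i : Idx P,
        (walkSum Z (walk (emb c.src) (stairWord i.2.1 (off i.1))) +
          walkSum Z (walk (walkEnd (emb c.src) (stairWord i.2.1 (off i.1))) (List.replicate P.L (c.dir, true))) -
          walkSum Z (walk (emb c.tgt) (stairWord i.2.2 (off i.1)))) -
      ((Fintype.card (Idx P) : ℂ))⁻¹ • ∑ i : Idx P, walkSum Z (walk (emb c.src) (stairWord i.2.1 (off i.1))) +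
      ((Fintype.card (Idx P) : ℂ))⁻¹ • ∑ i : Idx P, walkSum Z (walk (emb c.tgt) (stairWord i.2.1 (off i.1))) =
      ((Fintype.card (Idx P) : ℂ))⁻¹ • ∑ i : Idx P,
        walkSum Z (walk (walkEnd (emb c.src) (stairWord i.2.1 (off i.1))) (List.replicate P.L (c.dir, true))) := by
  have hσ' : ∑ i : Idx P, walkSum Z (walk (emb c.tgt) (stairWord i.2.2 (off i.1))) =
      ∑ i : Idx P, walkSum Z (walk (emb c.tgt) (stairWord i.2.1 (off i.1))) :=
    sum_idx_swap fun r σ => walkSum Z (walk (emb c.tgt) (stairWord σ (off r)))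
  rw [Finset.sum_sub_distrib, Finset.sum_add_distrib, hσ', smul_sub, smul_add]
  abel

set_option maxHeartbeats 400000 in
/-- ★★ **THE COVARIANT DOUBLE-BAR ONE STEP AT A BACKGROUND `U₀`** ([Balaban1985Averaging] (89) with print's `exp[mean log]` frames (82) over the route's
symmetrised staircase family).  Let `‖U₀(b) − 1‖ ≤ s₀`, `‖W(b) − 1‖ ≤ s₁` and `‖W(b) − U₀(b)‖ ≤ δ` on every bond with both ends in the two blocks of `c`, and
`120·ℓ·(s₀ + s₁) ≤ 1` (`ℓ = (d+2)L`).  Then the double-bar average of `W` in the frames twisted by `U₀`, RELATIVE to the single-bar average of the background,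
is `1` to first order in the DIFFERENCE reads with constant EXACTLY `L`:
`‖dbarCovU U₀ W c · (Ū₀(c))⁻¹ − 1‖ ≤ L·δ + 22100·ℓ²·(s₀+s₁)²` (`Ū₀ = emlAvgU U₀`) — the comb means of BOTH fields cancel against the frames
(`BlockAveragingEMLLinearised.sum_idx_swap`), leaving the mean of the straight-segment sums of `W − U₀`.  At `W = U₀` the quantity is exactly `1`
(`dbarCovU U₀ U₀ = Ū₀`); at `U₀ = 1` this is the flat one step `Prop8ChartDoubleBar.norm_dbarAvgU_sub_one_le`. [cite: Balaban1985Averaging, (58) p.27, (82) p.30, (89) p.31, (121)-(125) p.36] -/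
theorem norm_dbarCovU_mul_inv_sub_one_le (hj : j + 1 ≤ P.m + P.K) {U₀ W : GaugeField P j 𝔸ˣ} (c : PBond P (j + 1)) {s₀ s₁ δ : ℝ}
    (hs₀ : 0 ≤ s₀) (hs₁ : 0 ≤ s₁) (hδ : 0 ≤ δ) (hℓ : 120 * (((P.d + 2) * P.L : ℕ) : ℝ) * (s₀ + s₁) ≤ 1)
    (hU₀ : ∀ b : PBond P j, (blockOf b.src = c.src ∨ blockOf b.src = c.tgt) → (blockOf b.tgt = c.src ∨ blockOf b.tgt = c.tgt) →
      ‖((U₀ b : 𝔸ˣ) : 𝔸) - 1‖ ≤ s₀)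
    (hW : ∀ b : PBond P j, (blockOf b.src = c.src ∨ blockOf b.src = c.tgt) → (blockOf b.tgt = c.src ∨ blockOf b.tgt = c.tgt) →
      ‖((W b : 𝔸ˣ) : 𝔸) - 1‖ ≤ s₁)
    (hd : ∀ b : PBond P j, (blockOf b.src = c.src ∨ blockOf b.src = c.tgt) → (blockOf b.tgt = c.src ∨ blockOf b.tgt = c.tgt) →
      ‖((W b : 𝔸ˣ) : 𝔸) - ((U₀ b : 𝔸ˣ) : 𝔸)‖ ≤ δ) :
    ‖((dbarCovU U₀ W c : 𝔸ˣ) : 𝔸) * (((emlAvgU U₀ c)⁻¹ : 𝔸ˣ) : 𝔸) - 1‖ ≤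
      (P.L : ℝ) * δ + 22100 * (((P.d + 2) * P.L : ℕ) : ℝ) ^ 2 * (s₀ + s₁) ^ 2 := by
  rw [coe_dbarCovU]
  have hℓ0 : 0 ≤ (((P.d + 2) * P.L : ℕ) : ℝ) := Nat.cast_nonneg _
  have hS0 : 0 ≤ s₀ + s₁ := add_nonneg hs₀ hs₁
  have hθ0 : 0 ≤ (((P.d + 2) * P.L : ℕ) : ℝ) * (s₀ + s₁) := mul_nonneg hℓ0 hS0
  have hθ : (((P.d + 2) * P.L : ℕ) : ℝ) * (s₀ + s₁) ≤ 1 / 120 := by nlinarith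
  have h48₀ : 48 * (((P.d + 2) * P.L : ℕ) : ℝ) * s₀ ≤ 1 := by nlinarith [mul_nonneg hℓ0 hs₀, mul_nonneg hℓ0 hs₁]
  have h48₁ : 48 * (((P.d + 2) * P.L : ℕ) : ℝ) * s₁ ≤ 1 := by nlinarith [mul_nonneg hℓ0 hs₀, mul_nonneg hℓ0 hs₁]
  -- block hypotheses at the two ends
  have hU₀s : ∀ b : PBond P j, blockOf b.src = c.src → blockOf b.tgt = c.src → ‖((U₀ b : 𝔸ˣ) : 𝔸) - 1‖ ≤ s₀ := fun b h1 h2 => hU₀ b (Or.inl h1) (Or.inl h2)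
  have hU₀t : ∀ b : PBond P j, blockOf b.src = c.tgt → blockOf b.tgt = c.tgt → ‖((U₀ b : 𝔸ˣ) : 𝔸) - 1‖ ≤ s₀ := fun b h1 h2 => hU₀ b (Or.inr h1) (Or.inr h2)
  have hWs : ∀ b : PBond P j, blockOf b.src = c.src → blockOf b.tgt = c.src → ‖((W b : 𝔸ˣ) : 𝔸) - 1‖ ≤ s₁ := fun b h1 h2 => hW b (Or.inl h1) (Or.inl h2)
  have hWt : ∀ b : PBond P j, blockOf b.src = c.tgt → blockOf b.tgt = c.tgt → ‖((W b : 𝔸ˣ) : 𝔸) - 1‖ ≤ s₁ := fun b h1 h2 => hW b (Or.inr h1) (Or.inr h2)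
  -- the letters: frames at both ends, both single-bar averages, comb means and `Lin`s
  obtain ⟨hVm, hV1⟩ := norm_vframeCovU_sub_one_sub_le hj c.src hs₀ hs₁ hℓ hU₀s hWs
  obtain ⟨hVpm, hVp1⟩ := norm_vframeCovU_sub_one_sub_le hj c.tgt hs₀ hs₁ hℓ hU₀t hWt
  obtain ⟨hUlin, hU1⟩ := norm_emlAvgU_sub_one_sub_lin_le hj c hs₁ h48₁ hW
  obtain ⟨hU0lin, hU01⟩ := norm_emlAvgU_sub_one_sub_lin_le hj c hs₀ h48₀ hU₀
  have haW := norm_combSum_mean_le_of_block hj c.src hs₁ hWs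
  have haW' := norm_combSum_mean_le_of_block hj c.tgt hs₁ hWt
  have ha0 := norm_combSum_mean_le_of_block hj c.src hs₀ hU₀s
  have ha0' := norm_combSum_mean_le_of_block hj c.tgt hs₀ hU₀t
  -- the `Lin` sizes (`‖Lin‖ ≤ 17θ + 660θ² ≤ 24θ`)
  have hLin_of : ∀ {Ubar Lin : 𝔸} {s : ℝ}, 0 ≤ s → s ≤ s₀ + s₁ → ‖Ubar - 1 - Lin‖ ≤ 660 * (((P.d + 2) * P.L : ℕ) : ℝ) ^ 2 * s ^ 2 →
      ‖Ubar - 1‖ ≤ 17 * (((P.d + 2) * P.L : ℕ) : ℝ) * s → ‖Lin‖ ≤ 24 * ((((P.d + 2) * P.L : ℕ) : ℝ) * (s₀ + s₁)) := by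
    intro Ubar Lin s hs0 hsS hlin h1
    have e : Lin = (Ubar - 1) - (Ubar - 1 - Lin) := by abel
    rw [e]
    refine (norm_sub_le_of_le h1 hlin).trans ?_
    have hls : (((P.d + 2) * P.L : ℕ) : ℝ) * s ≤ (((P.d + 2) * P.L : ℕ) : ℝ) * (s₀ + s₁) := mul_le_mul_of_nonneg_left hsS hℓ0
    have : 660 * (((P.d + 2) * P.L : ℕ) : ℝ) ^ 2 * s ^ 2 = 660 * ((((P.d + 2) * P.L : ℕ) : ℝ) * s) * ((((P.d + 2) * P.L : ℕ) : ℝ) * s) := by ring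
    rw [this]
    nlinarith [mul_nonneg hℓ0 hs0]
  -- the exact first-order identity: `−(aW − a0) + (LinW + (a′W − a′0) − Lin0) = B_W − B_0`, with `‖B_W − B_0‖ ≤ L·δ`
  have hcW := lin_sub_comb_add_comb_eq_seg (fun b => ((W b : 𝔸ˣ) : 𝔸) - 1) c
  have hc0 := lin_sub_comb_add_comb_eq_seg (fun b => ((U₀ b : 𝔸ˣ) : 𝔸) - 1) c
  have hBdiff : ‖((Fintype.card (Idx P) : ℂ))⁻¹ • ∑ i : Idx P,
        walkSum (fun b => ((W b : 𝔸ˣ) : 𝔸) - 1) (walk (walkEnd (emb c.src) (stairWord i.2.1 (off i.1))) (List.replicate P.L (c.dir, true))) -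
      ((Fintype.card (Idx P) : ℂ))⁻¹ • ∑ i : Idx P,
        walkSum (fun b => ((U₀ b : 𝔸ˣ) : 𝔸) - 1) (walk (walkEnd (emb c.src) (stairWord i.2.1 (off i.1))) (List.replicate P.L (c.dir, true)))‖ ≤
      (P.L : ℝ) * δ := by
    rw [← smul_sub, ← Finset.sum_sub_distrib]
    refine norm_card_inv_smul_sum_le (by positivity) fun i => ?_
    rw [← walkSum_sub']
    have e : ((fun b : PBond P j => ((W b : 𝔸ˣ) : 𝔸) - 1) - fun b => ((U₀ b : 𝔸ˣ) : 𝔸) - 1) = fun b => ((W b : 𝔸ˣ) : 𝔸) - ((U₀ b : 𝔸ˣ) : 𝔸) := by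
      funext b; simp only [Pi.sub_apply]; abel
    rw [e]
    refine (norm_walkSum_le_of_steps (s := δ) _ _ fun st hst => ?_).trans (by rw [length_walk, List.length_replicate])
    have hmem : st ∈ walk (emb c.src) (loopWord P.L c.dir (off i.1) i.2.1 i.2.2) := by
      unfold loopWord; rw [walk_append, walk_append]; simp [hst]
    exact hd st.bond (two_block_of_mem_loopWalk hj c i hmem).1 (two_block_of_mem_loopWalk hj c i hmem).2
  -- assemble through the abstract bookkeeping at `θ := ℓ(s₀+s₁)`, `εB := L·δ`
  have hθsq : (((P.d + 2) * P.L : ℕ) : ℝ) ^ 2 * (s₀ + s₁) ^ 2 = ((((P.d + 2) * P.L : ℕ) : ℝ) * (s₀ + s₁)) ^ 2 := by ring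
  have hs₁S : s₁ ≤ s₀ + s₁ := by linarith
  have hs₀S : s₀ ≤ s₀ + s₁ := by linarith
  have hmono : ∀ {s : ℝ} {C : ℝ}, 0 ≤ C → 0 ≤ s → s ≤ s₀ + s₁ →
      C * (((P.d + 2) * P.L : ℕ) : ℝ) ^ 2 * s ^ 2 ≤ C * ((((P.d + 2) * P.L : ℕ) : ℝ) * (s₀ + s₁)) ^ 2 := by
    intro s C hC hs0 hsS
    have : (((P.d + 2) * P.L : ℕ) : ℝ) * s ≤ (((P.d + 2) * P.L : ℕ) : ℝ) * (s₀ + s₁) := mul_le_mul_of_nonneg_left hsS hℓ0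
    have h2 : ((((P.d + 2) * P.L : ℕ) : ℝ) * s) ^ 2 ≤ ((((P.d + 2) * P.L : ℕ) : ℝ) * (s₀ + s₁)) ^ 2 :=
      pow_le_pow_left₀ (mul_nonneg hℓ0 hs0) this 2
    calc C * (((P.d + 2) * P.L : ℕ) : ℝ) ^ 2 * s ^ 2 = C * ((((P.d + 2) * P.L : ℕ) : ℝ) * s) ^ 2 := by ring
      _ ≤ _ := mul_le_mul_of_nonneg_left h2 hC
  rw [show (22100 : ℝ) * (((P.d + 2) * P.L : ℕ) : ℝ) ^ 2 * (s₀ + s₁) ^ 2 = 22100 * ((((P.d + 2) * P.L : ℕ) : ℝ) * (s₀ + s₁)) ^ 2 by ring]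
  refine cov_dbar_bookkeeping hθ0 hθ (vframeCovU U₀ W c.src).inv_mul (emlAvgU U₀ c).inv_mul
    (hVm.trans (le_of_eq (by ring))) (hV1.trans (le_of_eq (by ring))) (hVpm.trans (le_of_eq (by ring))) (hVp1.trans (le_of_eq (by ring)))
    ((hUlin.trans (hmono (by norm_num) hs₁ hs₁S)))
    ((hU0lin.trans (hmono (by norm_num) hs₀ hs₀S))) (hU01.trans (by nlinarith [mul_nonneg hℓ0 hs₁]))
    ((norm_sub_le_of_le haW' ha0').trans (by nlinarith [mul_nonneg hℓ0 hs₀, mul_nonneg hℓ0 hs₁]))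
    (hLin_of hs₁ hs₁S hUlin hU1) (hLin_of hs₀ hs₀S hU0lin hU01) ?_ hBdiff
  rw [← hcW, ← hc0]
  abel


/-- **THE ABSOLUTE ONE-STEP ROW** for the full covariant double-bar field: with the background's own one-step letter `‖Ū₀(c) − 1‖ ≤ 17ℓs₀`
(`Prop8Chart.norm_emlAvgU_sub_one_sub_lin_le`), `‖(V̿W)(c) − 1‖ ≤ 17ℓs₀ + (1 + 17ℓs₀)·(L·δ + 22100·ℓ²·(s₀+s₁)²)` — from the relative row by
`X − 1 = (X·Ū₀⁻¹ − 1)·Ū₀ + (Ū₀ − 1)`. [cite: Balaban1985Averaging, (89) p.31, Prop. 3 (125) p.36] -/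
theorem norm_dbarCovU_sub_one_le (hj : j + 1 ≤ P.m + P.K) {U₀ W : GaugeField P j 𝔸ˣ} (c : PBond P (j + 1)) {s₀ s₁ δ : ℝ}
    (hs₀ : 0 ≤ s₀) (hs₁ : 0 ≤ s₁) (hδ : 0 ≤ δ) (hℓ : 120 * (((P.d + 2) * P.L : ℕ) : ℝ) * (s₀ + s₁) ≤ 1)
    (hU₀ : ∀ b : PBond P j, (blockOf b.src = c.src ∨ blockOf b.src = c.tgt) → (blockOf b.tgt = c.src ∨ blockOf b.tgt = c.tgt) →
      ‖((U₀ b : 𝔸ˣ) : 𝔸) - 1‖ ≤ s₀)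
    (hW : ∀ b : PBond P j, (blockOf b.src = c.src ∨ blockOf b.src = c.tgt) → (blockOf b.tgt = c.src ∨ blockOf b.tgt = c.tgt) →
      ‖((W b : 𝔸ˣ) : 𝔸) - 1‖ ≤ s₁)
    (hd : ∀ b : PBond P j, (blockOf b.src = c.src ∨ blockOf b.src = c.tgt) → (blockOf b.tgt = c.src ∨ blockOf b.tgt = c.tgt) →
      ‖((W b : 𝔸ˣ) : 𝔸) - ((U₀ b : 𝔸ˣ) : 𝔸)‖ ≤ δ) :
    ‖((dbarCovU U₀ W c : 𝔸ˣ) : 𝔸) - 1‖ ≤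
      17 * (((P.d + 2) * P.L : ℕ) : ℝ) * s₀ +
        (1 + 17 * (((P.d + 2) * P.L : ℕ) : ℝ) * s₀) *
          ((P.L : ℝ) * δ + 22100 * (((P.d + 2) * P.L : ℕ) : ℝ) ^ 2 * (s₀ + s₁) ^ 2) := by
  have hR := norm_dbarCovU_mul_inv_sub_one_le hj c hs₀ hs₁ hδ hℓ hU₀ hW hd
  have hℓ0 : 0 ≤ (((P.d + 2) * P.L : ℕ) : ℝ) := Nat.cast_nonneg _
  have h48₀ : 48 * (((P.d + 2) * P.L : ℕ) : ℝ) * s₀ ≤ 1 := by nlinarith [mul_nonneg hℓ0 hs₀, mul_nonneg hℓ0 hs₁]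
  have ha := (norm_emlAvgU_sub_one_sub_lin_le hj c hs₀ h48₀ hU₀).2
  have hY : ‖((emlAvgU U₀ c : 𝔸ˣ) : 𝔸)‖ ≤ 1 + 17 * (((P.d + 2) * P.L : ℕ) : ℝ) * s₀ := by
    have e : ((emlAvgU U₀ c : 𝔸ˣ) : 𝔸) = 1 + (((emlAvgU U₀ c : 𝔸ˣ) : 𝔸) - 1) := by abel
    rw [e]; exact norm_add_le_of_le (by rw [norm_one]) ha
  have e : ((dbarCovU U₀ W c : 𝔸ˣ) : 𝔸) - 1 =
      (((dbarCovU U₀ W c : 𝔸ˣ) : 𝔸) * (((emlAvgU U₀ c)⁻¹ : 𝔸ˣ) : 𝔸) - 1) * ((emlAvgU U₀ c : 𝔸ˣ) : 𝔸) +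
        (((emlAvgU U₀ c : 𝔸ˣ) : 𝔸) - 1) := by
    rw [sub_mul, mul_assoc, (emlAvgU U₀ c).inv_mul, mul_one, one_mul]; abel
  rw [e]
  calc _ ≤ ((P.L : ℝ) * δ + 22100 * (((P.d + 2) * P.L : ℕ) : ℝ) ^ 2 * (s₀ + s₁) ^ 2) * (1 + 17 * (((P.d + 2) * P.L : ℕ) : ℝ) * s₀) +
        17 * (((P.d + 2) * P.L : ℕ) : ℝ) * s₀ := norm_add_le_of_le ((norm_mul_le _ _).trans (mul_le_mul hR hY (norm_nonneg _) (by positivity))) ha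
    _ = _ := by ring

end Summit.QuantumFields.YangMills.Theorems.Prop7SymAvgTwSym

end
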